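import Literature.NumberTheory.EllipticCurves.IwasawaAlgebraRankOneIdealProofs
import Summits.BirchSwinnertonDyer.BirchSwinnertonDyer.Theorems.UniversalToricDescentEisensteinSplitControlLambda
import Mathlib.LinearAlgebra.Isomorphisms
import Mathlib.LinearAlgebra.Dimension.Localization
import Mathlib.LinearAlgebra.Dimension.Torsion.Finite
import HarnessLib

/-!
# Residual growth of a rank-one `Λ`-module (the converse of the residual corank-one μ-criterion)

Support file for crux `stmt-BirchSwinnertonDyer-24737` (`TwinAlgMuZeroAtThree`, line `beta-road` v7, stub
`stub_residualCorankLeOneMultOfBeta` = K2_res ∣ β; brick E7 of the LEAD's STUB BRIEF): the pure `Λ`-algebra step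
«structure ⟹ residual growth». For a finitely generated `Λ = ℤ_p⟦T⟧`-module `M` of rank one whose torsion submodule `t`
has FINITE residual quotient `t/p t` (equivalently `μ(t) = 0`), the residual layers grow like ONE copy of `Ω = 𝔽_p⟦T⟧`:
`#((M/pM) ⧸ T^{pⁿ}) ≤ p^{pⁿ + C}` for all `n` — the hypothesis `hgrowth` of
`…TwoSidedMuTransferHowardMuSupply.howardMu_of_residual_growth` and the converse of g21's
`…ResidualCorankOneCriterion.muInvariant_torsion_eq_zero_of_residual_growth`.

Proof (no structure theorem): `0 → t → M → F → 0` with `F = M/t` torsion-free of rank one, hence `F ≅ 𝔟` an ideal of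
finite index `c` (the rank-one reflexive hull, tree `IwasawaAlgebra.exists_linearEquiv_ideal_finite_quotient`); for the
two-generated ideal `J = (p, T^N)`: `#(M/JM) ≤ #(t/Jt) · #(F/JF)` (Lagrange), `#(t/Jt) ≤ #(t/pt)`,
`#(𝔟/J𝔟) ≤ #(Λ/J𝔟) = #(J/J𝔟) · #(Λ/J) ≤ c² · p^N` (`J/J𝔟` is a quotient of `(Λ/𝔟)²`; `#(Λ/(p,T^N)) = p^N` is w2 g10's
`natCard_lambda_quotient_span_C_X_pow`), and `(M/pM)/T^N` is a quotient of `M/JM`.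

References: Washington, *Introduction to Cyclotomic Fields*, §13.2; Bourbaki AC VII §4 no. 2; NSW (5.3.10).
-/

set_option linter.dupNamespace false
set_option autoImplicit false

noncomputable section
open scoped Classical
open PowerSeries

namespace Summit.BirchSwinnertonDyer.BirchSwinnertonDyer.Theorems.UniversalToricDescentResidualGrowthOfRankOne

open Literature.NumberTheory.EllipticCurves Literature.NumberTheory.EllipticCurves.IwasawaAlgebra
open Summit.BirchSwinnertonDyer.BirchSwinnertonDyer.Theorems.UniversalToricDescentEisensteinSplitControl

variable {p : ℕ} [hp : Fact p.Prime]

/-! ## §1 Counting over a commutative ring -/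

section Counting

variable {R : Type*} [CommRing R] {M : Type*} [AddCommGroup M] [Module R M]

/-- **`#(M/JM) ≤ #(t/Jt) · #((M/t)/J(M/t))`** for a submodule `t ≤ M` and an ideal `J` (Lagrange along
`JM ≤ JM + t`: `M/(JM + t) ≅ (M/t)/J(M/t)` and `(JM + t)/JM` is a quotient of `t/Jt`), together with the finiteness of
`M/JM` when the two outer quotients are finite. [folklore] -/
theorem finite_and_natCard_quotient_smul_top_le (J : Ideal R) (t : Submodule R M)
    [ht : Finite (↥t ⧸ (J • (⊤ : Submodule R ↥t)))] [hF : Finite ((M ⧸ t) ⧸ (J • (⊤ : Submodule R (M ⧸ t))))] :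
    Finite (M ⧸ (J • (⊤ : Submodule R M))) ∧
      Nat.card (M ⧸ (J • (⊤ : Submodule R M))) ≤
        Nat.card (↥t ⧸ (J • (⊤ : Submodule R ↥t))) * Nat.card ((M ⧸ t) ⧸ (J • (⊤ : Submodule R (M ⧸ t)))) := by
  set P : Submodule R M := J • ⊤ with hP
  -- Lagrange along `P ≤ P ⊔ t`
  have hlag := Submodule.card_quotient_mul_card_quotient (P ⊔ t) P le_sup_left
  -- `M ⧸ (P ⊔ t) ≃ (M ⧸ t) ⧸ J • ⊤`
  have hmap : (J • (⊤ : Submodule R (M ⧸ t))) = P.map t.mkQ := by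
    rw [hP, Submodule.map_smul'', Submodule.map_top, Submodule.range_mkQ]
  have e1 : ((M ⧸ t) ⧸ (J • (⊤ : Submodule R (M ⧸ t)))) ≃ₗ[R] M ⧸ (P ⊔ t) :=
    (Submodule.quotEquivOfEq _ _ hmap).trans
      ((Submodule.quotientQuotientEquivQuotientSup t P).trans (Submodule.quotEquivOfEq _ _ (sup_comm t P)))
  have hcard₁ : Nat.card (M ⧸ (P ⊔ t)) = Nat.card ((M ⧸ t) ⧸ (J • (⊤ : Submodule R (M ⧸ t)))) :=
    Nat.card_congr e1.toEquiv.symm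
  -- `(P ⊔ t).map P.mkQ = range (t → M ⧸ P)`, a quotient of `t ⧸ J • ⊤`
  let φ : ↥t →ₗ[R] M ⧸ P := P.mkQ ∘ₗ t.subtype
  have hrange : (P ⊔ t).map P.mkQ = LinearMap.range φ := by
    rw [Submodule.map_sup, Submodule.mkQ_map_self, bot_sup_eq, LinearMap.range_comp, Submodule.range_subtype]
  have hker : (J • (⊤ : Submodule R ↥t)) ≤ LinearMap.ker φ := by
    refine Submodule.smul_le.mpr fun r hr x _ ↦ ?_
    rw [LinearMap.mem_ker, LinearMap.comp_apply, Submodule.coe_subtype, Submodule.mkQ_apply,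
      Submodule.Quotient.mk_eq_zero, Submodule.coe_smul, hP]
    exact Submodule.smul_mem_smul hr Submodule.mem_top
  let ψ : (↥t ⧸ (J • (⊤ : Submodule R ↥t))) →ₗ[R] M ⧸ P := Submodule.liftQ (J • (⊤ : Submodule R ↥t)) φ hker
  have hψrange : LinearMap.range ψ = LinearMap.range φ := Submodule.range_liftQ (J • (⊤ : Submodule R ↥t)) φ hker
  have hcard₂ : Nat.card ((P ⊔ t).map P.mkQ) ≤ Nat.card (↥t ⧸ (J • (⊤ : Submodule R ↥t))) := by
    rw [hrange, ← hψrange]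
    exact Nat.card_le_card_of_surjective _ ψ.surjective_rangeRestrict
  haveI : Finite ((P ⊔ t).map P.mkQ) := by
    rw [hrange, ← hψrange]
    exact Finite.of_surjective _ ψ.surjective_rangeRestrict
  -- finiteness of `M ⧸ P` from the Lagrange identity
  have hne : Nat.card (M ⧸ P) ≠ 0 := by
    rw [← hlag, hcard₁]
    exact Nat.mul_ne_zero Nat.card_pos.ne' Nat.card_pos.ne'
  refine ⟨Nat.finite_of_card_ne_zero hne, ?_⟩
  rw [← hlag, hcard₁]
  exact Nat.mul_le_mul_right _ hcard₂

/-- **`#(𝔟/J𝔟) ≤ #(Λ/J) · #(Λ/𝔟)²`** for ideals `𝔟`, `J = (x, y)` of finite index in a commutative ring: `𝔟/J𝔟 ↪ Λ/J𝔟`,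
`#(Λ/J𝔟) = #(J/J𝔟) · #(Λ/J)` (Lagrange) and `J/J𝔟` is the image of `(Λ/𝔟)² → Λ/J𝔟, (a, b) ↦ ax + by`. [folklore] -/
theorem finite_and_natCard_ideal_quotient_smul_top_le (J 𝔟 : Ideal R) (x y : R) (hJ : J = Ideal.span {x, y})
    [h𝔟 : Finite (R ⧸ 𝔟)] [hJfin : Finite (R ⧸ J)] :
    Finite (↥𝔟 ⧸ (J • (⊤ : Submodule R ↥𝔟))) ∧
      Nat.card (↥𝔟 ⧸ (J • (⊤ : Submodule R ↥𝔟))) ≤ Nat.card (R ⧸ J) * (Nat.card (R ⧸ 𝔟) * Nat.card (R ⧸ 𝔟)) := by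
  -- Lagrange along `J𝔟 ≤ J`
  have hlag := Submodule.card_quotient_mul_card_quotient J (J * 𝔟) Ideal.mul_le_right
  -- `J/J𝔟` is the image of `(Λ/𝔟)²`
  have hkerg : ∀ g ∈ J, 𝔟 ≤ LinearMap.ker ((J * 𝔟).mkQ ∘ₗ LinearMap.mulRight R g) := by
    intro g hg r hr
    rw [LinearMap.mem_ker, LinearMap.comp_apply, LinearMap.mulRight_apply, Submodule.mkQ_apply,
      Submodule.Quotient.mk_eq_zero]
    have h := Ideal.mul_mem_mul hr hg
    rwa [mul_comm 𝔟 J] at h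
  have hx : x ∈ J := by rw [hJ]; exact Ideal.subset_span (Set.mem_insert _ _)
  have hy : y ∈ J := by rw [hJ]; exact Ideal.subset_span (Set.mem_insert_of_mem _ (Set.mem_singleton _))
  let φx : (R ⧸ 𝔟) →ₗ[R] R ⧸ (J * 𝔟) := 𝔟.liftQ ((J * 𝔟).mkQ ∘ₗ LinearMap.mulRight R x) (hkerg x hx)
  let φy : (R ⧸ 𝔟) →ₗ[R] R ⧸ (J * 𝔟) := 𝔟.liftQ ((J * 𝔟).mkQ ∘ₗ LinearMap.mulRight R y) (hkerg y hy)
  let Φ : (R ⧸ 𝔟) × (R ⧸ 𝔟) →ₗ[R] R ⧸ (J * 𝔟) := φx.coprod φy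
  have hJle : Submodule.map (J * 𝔟).mkQ J ≤ LinearMap.range Φ := by
    rintro _ ⟨j, hj, rfl⟩
    rw [hJ, SetLike.mem_coe, Ideal.mem_span_pair] at hj
    obtain ⟨a, b, rfl⟩ := hj
    refine ⟨(Submodule.Quotient.mk a, Submodule.Quotient.mk b), ?_⟩
    simp only [Φ, φx, φy, LinearMap.coprod_apply, Submodule.liftQ_apply, LinearMap.comp_apply,
      LinearMap.mulRight_apply, map_add]
  haveI : Finite (LinearMap.range Φ) := Finite.of_surjective _ Φ.surjective_rangeRestrict
  have hcardJ : Nat.card (Submodule.map (J * 𝔟).mkQ J) ≤ Nat.card (R ⧸ 𝔟) * Nat.card (R ⧸ 𝔟) := by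
    calc Nat.card (Submodule.map (J * 𝔟).mkQ J) ≤ Nat.card (LinearMap.range Φ) :=
          Nat.card_le_card_of_injective (Submodule.inclusion hJle) (Submodule.inclusion_injective hJle)
      _ ≤ Nat.card ((R ⧸ 𝔟) × (R ⧸ 𝔟)) := Nat.card_le_card_of_surjective _ Φ.surjective_rangeRestrict
      _ = Nat.card (R ⧸ 𝔟) * Nat.card (R ⧸ 𝔟) := Nat.card_prod _ _
  haveI : Finite (Submodule.map (J * 𝔟).mkQ J) :=
    Finite.of_injective (Submodule.inclusion hJle) (Submodule.inclusion_injective hJle)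
  -- finiteness of `Λ ⧸ J𝔟`
  have hne : Nat.card (R ⧸ (J * 𝔟)) ≠ 0 := by
    rw [← hlag]
    exact Nat.mul_ne_zero Nat.card_pos.ne' Nat.card_pos.ne'
  haveI : Finite (R ⧸ (J * 𝔟)) := Nat.finite_of_card_ne_zero hne
  -- `𝔟/J𝔟 ↪ Λ/J𝔟`
  have hker : (J • (⊤ : Submodule R ↥𝔟)) ≤ LinearMap.ker ((J * 𝔟).mkQ ∘ₗ 𝔟.subtype) := by
    refine Submodule.smul_le.mpr fun r hr z _ ↦ ?_
    rw [LinearMap.mem_ker, LinearMap.comp_apply, Submodule.coe_subtype, Submodule.mkQ_apply,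
      Submodule.Quotient.mk_eq_zero, Submodule.coe_smul, smul_eq_mul]
    exact Ideal.mul_mem_mul hr z.2
  let ι : (↥𝔟 ⧸ (J • (⊤ : Submodule R ↥𝔟))) →ₗ[R] R ⧸ (J * 𝔟) :=
    Submodule.liftQ (J • (⊤ : Submodule R ↥𝔟)) ((J * 𝔟).mkQ ∘ₗ 𝔟.subtype) hker
  have hmap : (J • (⊤ : Submodule R ↥𝔟)).map 𝔟.subtype = J * 𝔟 := by
    rw [Submodule.map_smul'', Submodule.map_top, Submodule.range_subtype]; rfl
  have hι : Function.Injective ι := by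
    rw [← LinearMap.ker_eq_bot, Submodule.ker_liftQ, Submodule.eq_bot_iff]
    rintro q ⟨z, hz, rfl⟩
    have hz' : ((z : ↥𝔟) : R) ∈ J * 𝔟 := by
      have h := hz
      rw [SetLike.mem_coe, LinearMap.mem_ker] at h
      exact (Submodule.Quotient.mk_eq_zero _).mp h
    -- `↑z ∈ J𝔟 = (J • ⊤).map 𝔟.subtype`, so `z ∈ J • ⊤`
    rw [← hmap] at hz'
    obtain ⟨w, hw, hwz⟩ := hz'
    have hwz' : w = z := Subtype.ext hwz
    rw [Submodule.mkQ_apply, Submodule.Quotient.mk_eq_zero, ← hwz']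
    exact hw
  refine ⟨Finite.of_injective ι hι, ?_⟩
  calc Nat.card (↥𝔟 ⧸ (J • (⊤ : Submodule R ↥𝔟))) ≤ Nat.card (R ⧸ (J * 𝔟)) := Nat.card_le_card_of_injective ι hι
    _ = Nat.card (Submodule.map (J * 𝔟).mkQ J) * Nat.card (R ⧸ J) := hlag.symm
    _ ≤ (Nat.card (R ⧸ 𝔟) * Nat.card (R ⧸ 𝔟)) * Nat.card (R ⧸ J) := Nat.mul_le_mul_right _ hcardJ
    _ = Nat.card (R ⧸ J) * (Nat.card (R ⧸ 𝔟) * Nat.card (R ⧸ 𝔟)) := Nat.mul_comm _ _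

/-- Transport of `#(M/JM)` along a linear equivalence. [folklore] -/
theorem natCard_quotient_smul_top_congr {N : Type*} [AddCommGroup N] [Module R N] (J : Ideal R) (e : M ≃ₗ[R] N) :
    Nat.card (M ⧸ (J • (⊤ : Submodule R M))) = Nat.card (N ⧸ (J • (⊤ : Submodule R N))) := by
  refine Nat.card_congr (Submodule.Quotient.equiv (J • ⊤) (J • ⊤) e ?_).toEquiv
  rw [Submodule.map_smul'', Submodule.map_top, LinearEquiv.range]

/-- **`(M/𝔞M)/(𝔠 · (M/𝔞M))` is a quotient of `M/JM`** whenever `J ≤ 𝔞 + 𝔠`. [folklore] -/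
theorem natCard_quotient_quotient_le (𝔞 𝔠 J : Ideal R) (hJ : J ≤ 𝔞 ⊔ 𝔠)
    [Finite (M ⧸ (J • (⊤ : Submodule R M)))] :
    Nat.card ((M ⧸ (𝔞 • (⊤ : Submodule R M))) ⧸
        (𝔠 • (⊤ : Submodule R (M ⧸ (𝔞 • (⊤ : Submodule R M)))))) ≤ Nat.card (M ⧸ (J • (⊤ : Submodule R M))) := by
  let A : Submodule R M := 𝔞 • ⊤
  let B : Submodule R (M ⧸ A) := 𝔠 • ⊤
  let f : M →ₗ[R] (M ⧸ A) ⧸ B := B.mkQ ∘ₗ A.mkQ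
  have hf : Function.Surjective f :=
    (Submodule.mkQ_surjective _).comp (Submodule.mkQ_surjective _)
  have hker : (J • (⊤ : Submodule R M)) ≤ LinearMap.ker f := by
    refine Submodule.smul_le.mpr fun r hr m _ ↦ ?_
    obtain ⟨a, ha, c, hc, rfl⟩ := Submodule.mem_sup.mp (hJ hr)
    rw [LinearMap.mem_ker, add_smul, map_add]
    have h1 : f (a • m) = 0 := by
      have ha' : A.mkQ (a • m) = 0 :=
        (Submodule.Quotient.mk_eq_zero _).mpr (Submodule.smul_mem_smul ha Submodule.mem_top)
      change B.mkQ (A.mkQ (a • m)) = 0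
      rw [ha', map_zero]
    have h2 : f (c • m) = 0 := by
      change B.mkQ (A.mkQ (c • m)) = 0
      rw [map_smul, Submodule.mkQ_apply, Submodule.Quotient.mk_eq_zero]
      exact Submodule.smul_mem_smul hc Submodule.mem_top
    rw [h1, h2, add_zero]
  let g := Submodule.liftQ (J • (⊤ : Submodule R M)) f hker
  have hg : Function.Surjective g := by
    rw [← LinearMap.range_eq_top, Submodule.range_liftQ, LinearMap.range_eq_top]
    exact hf
  exact Nat.card_le_card_of_surjective g hg

/-- A quotient by a bigger ideal is smaller: `#(M/J M) ≤ #(M/𝔞 M)` for `𝔞 ≤ J`, with finiteness. [folklore] -/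
theorem finite_and_natCard_quotient_smul_top_mono {𝔞 J : Ideal R} (h : 𝔞 ≤ J)
    [Finite (M ⧸ (𝔞 • (⊤ : Submodule R M)))] :
    Finite (M ⧸ (J • (⊤ : Submodule R M))) ∧
      Nat.card (M ⧸ (J • (⊤ : Submodule R M))) ≤ Nat.card (M ⧸ (𝔞 • (⊤ : Submodule R M))) := by
  have hle : (𝔞 • (⊤ : Submodule R M)) ≤ J • ⊤ := Submodule.smul_mono_left h
  exact ⟨Finite.of_surjective _ (Submodule.factor_surjective hle),
    Nat.card_le_card_of_surjective _ (Submodule.factor_surjective hle)⟩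

end Counting

/-! ## §2 The residual growth of a rank-one `Λ`-module -/

section Lambda

variable {M : Type*} [AddCommGroup M] [Module (IwasawaAlgebra p) M]

/-- **Residual growth in rank one.** Let `M` be a finitely generated `Λ`-module of rank one whose torsion submodule `t` has
finite residual quotient `t/p·t` (this is `μ(t) = 0`). Then there is `C` with `#((M/pM) ⧸ T^{pⁿ}) ≤ p^{pⁿ + C}` for every
`n` — the residual layers grow like ONE copy of `𝔽_p⟦T⟧`. (Converse of the residual corank-one μ-criterion; the `hgrowth`
input of `…HowardMuSupply.howardMu_of_residual_growth`.) [cite: Washington1997, §13.2] [cite: BourbakiAC5to7, Ch. VII §4 no. 2] -/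
theorem residual_growth_of_rank_one [Module.Finite (IwasawaAlgebra p) M]
    (hrank : Module.rank (IwasawaAlgebra p) M = 1)
    (hfin : Finite (↥(Submodule.torsion (IwasawaAlgebra p) M) ⧸
      (augIdealP p • (⊤ : Submodule (IwasawaAlgebra p) ↥(Submodule.torsion (IwasawaAlgebra p) M))))) :
    ∃ C : ℕ, ∀ n : ℕ, Nat.card ((M ⧸ (augIdealP p • (⊤ : Submodule (IwasawaAlgebra p) M))) ⧸
      (Ideal.span {((PowerSeries.X : IwasawaAlgebra p) ^ (p ^ n))} •
        (⊤ : Submodule (IwasawaAlgebra p) (M ⧸ (augIdealP p • (⊤ : Submodule (IwasawaAlgebra p) M)))))) ≤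
      p ^ (p ^ n + C) := by
  haveI := hfin
  have hp1 : 1 < p := hp.out.one_lt
  set t := Submodule.torsion (IwasawaAlgebra p) M with ht
  let F := M ⧸ t
  -- `F = M/t` is torsion-free of rank one, hence an ideal of finite index
  have hrankF : Module.rank (IwasawaAlgebra p) F = 1 := by
    have h := rank_quotient_add_rank_of_isDomain t
    rw [rank_eq_zero_iff_isTorsion.mpr (Submodule.torsion_isTorsion (R := IwasawaAlgebra p) (M := M)),
      add_zero, hrank] at h
    exact h
  obtain ⟨𝔟, h𝔟fin, -, ⟨e⟩⟩ := IwasawaAlgebra.exists_linearEquiv_ideal_finite_quotient (M := F) hrankF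
  haveI := h𝔟fin
  set c := Nat.card (IwasawaAlgebra p ⧸ 𝔟) with hc
  set c₁ := Nat.card (↥t ⧸ (augIdealP p • (⊤ : Submodule (IwasawaAlgebra p) ↥t))) with hc₁
  refine ⟨c₁ * (c * c), fun n ↦ ?_⟩
  have hN : 1 ≤ p ^ n := Nat.one_le_pow _ _ hp.out.pos
  set J : Ideal (IwasawaAlgebra p) :=
    Ideal.span {PowerSeries.C (p : ℤ_[p]), (PowerSeries.X : IwasawaAlgebra p) ^ (p ^ n)} with hJ
  have hJcard : Nat.card (IwasawaAlgebra p ⧸ J) = p ^ (p ^ n) := natCard_lambda_quotient_span_C_X_pow p hN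
  haveI : Finite (IwasawaAlgebra p ⧸ J) :=
    Nat.finite_of_card_ne_zero (by rw [hJcard]; exact pow_ne_zero _ hp.out.ne_zero)
  -- the free part
  obtain ⟨h𝔟J, h𝔟le⟩ := finite_and_natCard_ideal_quotient_smul_top_le J 𝔟 (PowerSeries.C (p : ℤ_[p]))
    ((PowerSeries.X : IwasawaAlgebra p) ^ (p ^ n)) hJ
  haveI := h𝔟J
  have hFcard : Nat.card (F ⧸ (J • (⊤ : Submodule (IwasawaAlgebra p) F))) =
      Nat.card (↥𝔟 ⧸ (J • (⊤ : Submodule (IwasawaAlgebra p) ↥𝔟))) := natCard_quotient_smul_top_congr J e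
  haveI : Finite (F ⧸ (J • (⊤ : Submodule (IwasawaAlgebra p) F))) :=
    Nat.finite_of_card_ne_zero (by rw [hFcard]; exact Nat.card_pos.ne')
  -- the torsion part: `𝔞 ≤ J`
  have h𝔞J : augIdealP p ≤ J := Ideal.span_mono (Set.singleton_subset_iff.mpr (Set.mem_insert _ _))
  obtain ⟨htJ, htle⟩ := finite_and_natCard_quotient_smul_top_mono (M := ↥t) h𝔞J
  haveI := htJ
  -- Lagrange
  obtain ⟨hMJ, hMle⟩ := finite_and_natCard_quotient_smul_top_le (M := M) J t
  haveI := hMJ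
  -- the double quotient is a quotient of `M/JM`
  have hJsup : J ≤ augIdealP p ⊔ Ideal.span {(PowerSeries.X : IwasawaAlgebra p) ^ (p ^ n)} := by
    rw [hJ, Ideal.span_insert]
    exact le_rfl
  have hdq := natCard_quotient_quotient_le (M := M) (augIdealP p)
    (Ideal.span {(PowerSeries.X : IwasawaAlgebra p) ^ (p ^ n)}) J hJsup
  -- numerics
  have hnum : c₁ * (p ^ (p ^ n) * (c * c)) ≤ p ^ (p ^ n + c₁ * (c * c)) := by
    rw [pow_add, Nat.mul_left_comm]
    exact Nat.mul_le_mul_left _ (Nat.lt_pow_self hp1).le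
  calc Nat.card ((M ⧸ (augIdealP p • (⊤ : Submodule (IwasawaAlgebra p) M))) ⧸
          (Ideal.span {((PowerSeries.X : IwasawaAlgebra p) ^ (p ^ n))} •
            (⊤ : Submodule (IwasawaAlgebra p) (M ⧸ (augIdealP p • (⊤ : Submodule (IwasawaAlgebra p) M))))))
        ≤ Nat.card (M ⧸ (J • (⊤ : Submodule (IwasawaAlgebra p) M))) := hdq
    _ ≤ Nat.card (↥t ⧸ (J • (⊤ : Submodule (IwasawaAlgebra p) ↥t))) *
          Nat.card (F ⧸ (J • (⊤ : Submodule (IwasawaAlgebra p) F))) := hMle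
    _ ≤ c₁ * (p ^ (p ^ n) * (c * c)) := Nat.mul_le_mul htle (by rw [hFcard, ← hJcard]; exact h𝔟le)
    _ ≤ p ^ (p ^ n + c₁ * (c * c)) := hnum

end Lambda


end Summit.BirchSwinnertonDyer.BirchSwinnertonDyer.Theorems.UniversalToricDescentResidualGrowthOfRankOne

end
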